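import Summits.Ventures.YMGap.Thresholds.CouplingDerivativeTools
import Summits.Ventures.YMGap.RobustBall.Defs
import Mathlib.MeasureTheory.Measure.Tilted
import HarnessLib

/-!
# Venture YMGap, track ROBUST-BALL (Y2) — tools: Lipschitz-cylinder calculus (exponential, sums, larger supports) and the
# covariance of a tilted probability measure

HONEST FRAMING. WHAT THIS IS: a venture tool file (cell `pub-ymgap`, track Y2 ROBUST-BALL, seat rb-p1, theorems only, no door, no
number) serving `LocalSourceClustering.lean`:
* `isLipschitzCylinder_of_subset` (larger support, same constant), `isLipschitzCylinder_exp_of_abs_le` / `_exp_neg_` (`e^{±H}` for a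
  Lipschitz cylinder `H` with `|H| ≤ B`: constant `e^{B} K`, via the Literature bound `abs_exp_sub_exp_le_of_le`),
  `isLipschitzCylinder_finset_sum` (sum of the constants) — completing ds-1's `isLipschitzCylinder_mul`;
* `covariance_tilted_eq` — for a probability measure `μ`, bounded measurable `f, F, G`, `e = e^{f}`, `Z = μ(e)`:
  `cov_{μ.tilted f}(F, G) = cov_μ(eF, G)/Z − (μ(eF)/Z) · cov_μ(e, G)/Z`; `abs_covariance_tilted_le` —
  `|cov_{μ.tilted f}(F, G)| ≤ e^{B}|cov_μ(eF, G)| + e^{B} M_F |cov_μ(e, G)|` (`|f| ≤ B`, `|F| ≤ M_F`); `sqrt_integral_sq_le`.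
WHAT THIS IS NOT: pure bookkeeping; nothing about any model.
-/

noncomputable section

open MeasureTheory Function Finset Real ProbabilityTheory
open scoped NNReal
open Literature.Probability.LatticeModels
open Literature.MathematicalPhysics.QuantumLattice
open Literature.MathematicalPhysics.QuantumFieldTheory hiding ZdEdge Site
open Summit.Ventures.YMGap.ZdSmoothing Summit.Ventures.YMGap.CouplingResponse

namespace Summit.Ventures.YMGap.RobustBall

variable {d N : ℕ}


/-! ### Lipschitz cylinder calculus: exponentials, sums, larger supports -/

section Cylinders

/-- A Lipschitz cylinder on `Λ` is a Lipschitz cylinder on every larger link set, with the same constant. -/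
theorem isLipschitzCylinder_of_subset {F : LGConfig d (SUN N) → ℝ} {Λ Λ' : Finset (ZdEdge d)} {K : ℝ≥0}
    (h : IsLipschitzCylinder (fundamentalRep (Fin N)) F Λ K) (hΛ : Λ ⊆ Λ') :
    IsLipschitzCylinder (fundamentalRep (Fin N)) F Λ' K := by
  obtain ⟨f, hf, hF⟩ := h.exists_suEntries
  refine isLipschitzCylinder_of_dist_le fun U V => ?_
  rw [hF, hF, ← Real.dist_eq]
  exact (hf.dist_le_mul _ _).trans (mul_le_mul_of_nonneg_left (dist_restrict_le hΛ U V) K.2)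

/-- **The exponential of a bounded Lipschitz cylinder is a Lipschitz cylinder**: `|H| ≤ B` on `Λ` with constant `K` gives
`e^{H}` (and `e^{−H}`) on `Λ` with constant `e^{B} K`. -/
theorem isLipschitzCylinder_exp_of_abs_le {H : LGConfig d (SUN N) → ℝ} {Λ : Finset (ZdEdge d)} {K : ℝ≥0}
    (h : IsLipschitzCylinder (fundamentalRep (Fin N)) H Λ K) {B : ℝ} (hB : ∀ U, |H U| ≤ B) :
    IsLipschitzCylinder (fundamentalRep (Fin N)) (fun U => exp (H U)) Λ ((exp B).toNNReal * K) := by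
  obtain ⟨f, hf, hF⟩ := h.exists_suEntries
  refine isLipschitzCylinder_of_dist_le fun U V => ?_
  have hd : |H U - H V| ≤ K * dist (fun e : ↥Λ => suEntries (U e)) (fun e : ↥Λ => suEntries (V e)) := by
    rw [hF, hF, ← Real.dist_eq]; exact hf.dist_le_mul _ _
  calc |exp (H U) - exp (H V)| ≤ exp B * |H U - H V| := abs_exp_sub_exp_le_of_le (abs_le.1 (hB U)).2 (abs_le.1 (hB V)).2
    _ ≤ exp B * (K * dist (fun e : ↥Λ => suEntries (U e)) (fun e : ↥Λ => suEntries (V e))) :=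
        mul_le_mul_of_nonneg_left hd (exp_pos B).le
    _ = (((exp B).toNNReal * K : ℝ≥0) : ℝ) * dist (fun e : ↥Λ => suEntries (U e)) (fun e : ↥Λ => suEntries (V e)) := by
        rw [NNReal.coe_mul, Real.coe_toNNReal _ (exp_pos B).le]; ring

/-- The exponential of MINUS a bounded Lipschitz cylinder: constant `e^{B} K`. -/
theorem isLipschitzCylinder_exp_neg_of_abs_le {H : LGConfig d (SUN N) → ℝ} {Λ : Finset (ZdEdge d)} {K : ℝ≥0}
    (h : IsLipschitzCylinder (fundamentalRep (Fin N)) H Λ K) {B : ℝ} (hB : ∀ U, |H U| ≤ B) :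
    IsLipschitzCylinder (fundamentalRep (Fin N)) (fun U => exp (-H U)) Λ ((exp B).toNNReal * K) := by
  obtain ⟨f, hf, hF⟩ := h.exists_suEntries
  have hneg : IsLipschitzCylinder (fundamentalRep (Fin N)) (fun U => -H U) Λ K := by
    refine isLipschitzCylinder_of_dist_le fun U V => ?_
    rw [show -H U - -H V = -(H U - H V) by ring, abs_neg, hF, hF, ← Real.dist_eq]
    exact hf.dist_le_mul _ _
  exact isLipschitzCylinder_exp_of_abs_le hneg fun U => by rw [abs_neg]; exact hB U

/-- **A finite sum of Lipschitz cylinders is a Lipschitz cylinder** on any link set containing all the supports, with the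
sum of the constants. -/
theorem isLipschitzCylinder_finset_sum {V : Potential (ZdEdge d) (SUN N)} {T : Finset (Finset (ZdEdge d))}
    {K : Finset (ZdEdge d) → ℝ≥0} (hV : ∀ X ∈ T, IsLipschitzCylinder (fundamentalRep (Fin N)) (V X) X (K X))
    {S : Finset (ZdEdge d)} (hS : ∀ X ∈ T, X ⊆ S) :
    IsLipschitzCylinder (fundamentalRep (Fin N)) (fun U => ∑ X ∈ T, V X U) S (∑ X ∈ T, K X) := by
  refine isLipschitzCylinder_of_dist_le fun U U' => ?_
  set δ := dist (fun e : ↥S => suEntries (U e)) (fun e : ↥S => suEntries (U' e)) with hδ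
  have hd : ∀ X ∈ T, |V X U - V X U'| ≤ K X * δ := fun X hX => by
    obtain ⟨f, hf, hF⟩ := (hV X hX).exists_suEntries
    rw [hF, hF, ← Real.dist_eq]
    exact (hf.dist_le_mul _ _).trans (mul_le_mul_of_nonneg_left (dist_restrict_le (hS X hX) U U') (K X).2)
  calc |∑ X ∈ T, V X U - ∑ X ∈ T, V X U'| = |∑ X ∈ T, (V X U - V X U')| := by rw [Finset.sum_sub_distrib]
    _ ≤ ∑ X ∈ T, |V X U - V X U'| := Finset.abs_sum_le_sum_abs _ _
    _ ≤ ∑ X ∈ T, (K X : ℝ) * δ := Finset.sum_le_sum hd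
    _ = ((∑ X ∈ T, K X : ℝ≥0) : ℝ) * δ := by rw [← Finset.sum_mul]; push_cast; rfl

end Cylinders

/-! ### The covariance of a tilted probability measure -/

section Tilt

variable {Ω : Type*} [MeasurableSpace Ω] {μ : Measure Ω} [IsProbabilityMeasure μ]

/-- Bounded measurable functions are integrable on a probability space. -/
private theorem integrable_of_abs_le' {X : Ω → ℝ} (hX : Measurable X) {C : ℝ} (hC : ∀ ω, |X ω| ≤ C) : Integrable X μ :=
  Integrable.of_bound hX.aestronglyMeasurable C (ae_of_all _ fun ω => by rw [Real.norm_eq_abs]; exact hC ω)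

omit [IsProbabilityMeasure μ] in
/-- Expectations in the tilted state as quotients. -/
private theorem integral_tilted_div' (f X : Ω → ℝ) :
    ∫ ω, X ω ∂(μ.tilted f) = (∫ ω, exp (f ω) * X ω ∂μ) / ∫ ω, exp (f ω) ∂μ := by
  rw [integral_tilted, ← integral_div]
  refine integral_congr_ae (ae_of_all _ fun ω => ?_)
  simp only [smul_eq_mul]
  ring

/-- `√(∫ X² dμ) ≤ M` when `|X| ≤ M`. -/
theorem sqrt_integral_sq_le {X : Ω → ℝ} {M : ℝ} (hM : 0 ≤ M) (hX : ∀ ω, |X ω| ≤ M) :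
    Real.sqrt (∫ ω, X ω ^ 2 ∂μ) ≤ M := by
  refine Real.sqrt_le_iff.2 ⟨hM, ?_⟩
  have hle : ∀ ω, X ω ^ 2 ≤ M ^ 2 := fun ω => by
    rw [← sq_abs]; exact pow_le_pow_left₀ (abs_nonneg _) (hX ω) 2
  calc ∫ ω, X ω ^ 2 ∂μ ≤ ∫ _ω, M ^ 2 ∂μ := by
        by_cases hint : Integrable (fun ω => X ω ^ 2) μ
        · exact integral_mono hint (integrable_const _) hle
        · rw [integral_undef hint]; exact integral_nonneg fun _ => sq_nonneg M
    _ = M ^ 2 := by simp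

/-- **THE COVARIANCE OF A TILTED STATE** (`e = e^{f}`, `Z = μ(e)`):
`cov_{μ.tilted f}(F, G) = cov_μ(eF, G)/Z − (μ(eF)/Z) · (cov_μ(e, G)/Z)`. -/
theorem covariance_tilted_eq {f F G : Ω → ℝ} (hfm : Measurable f) {B : ℝ} (hfb : ∀ ω, |f ω| ≤ B)
    (hFm : Measurable F) {CF : ℝ} (hFb : ∀ ω, |F ω| ≤ CF) (hGm : Measurable G) {CG : ℝ} (hGb : ∀ ω, |G ω| ≤ CG) :
    cov[F, G; μ.tilted f] =
      cov[fun ω => exp (f ω) * F ω, G; μ] / (∫ ω, exp (f ω) ∂μ) -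
        (∫ ω, exp (f ω) * F ω ∂μ) / (∫ ω, exp (f ω) ∂μ) * (cov[fun ω => exp (f ω), G; μ] / ∫ ω, exp (f ω) ∂μ) := by
  have heb : ∀ ω, |exp (f ω)| ≤ exp B := fun ω => by
    rw [abs_of_pos (exp_pos _)]; exact exp_le_exp.2 (abs_le.1 (hfb ω)).2
  have hem : Measurable fun ω => exp (f ω) := hfm.exp
  have hint : Integrable (fun ω => exp (f ω)) μ := integrable_of_abs_le' hem heb
  haveI : IsProbabilityMeasure (μ.tilted f) := isProbabilityMeasure_tilted hint
  have hZ : 0 < ∫ ω, exp (f ω) ∂μ := integral_exp_pos hint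
  obtain ⟨ω₀⟩ : Nonempty Ω := by
    by_contra h
    rw [not_nonempty_iff] at h
    have h1 := IsProbabilityMeasure.measure_univ (μ := μ)
    rw [Set.univ_eq_empty_iff.2 h, measure_empty] at h1
    exact zero_ne_one h1
  have hCF : 0 ≤ CF := (abs_nonneg _).trans (hFb ω₀)
  have heFb : ∀ ω, |exp (f ω) * F ω| ≤ exp B * CF := fun ω => by
    rw [abs_mul]; exact mul_le_mul (heb ω) (hFb ω) (abs_nonneg _) (exp_pos B).le
  -- all covariances in moments
  rw [covariance_eq_sub_of_abs_le hFm hGm hFb hGb,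
    covariance_eq_sub_of_abs_le (show Measurable (fun ω => exp (f ω) * F ω) from hem.mul hFm) hGm heFb hGb,
    covariance_eq_sub_of_abs_le hem hGm heb hGb]
  -- all tilted expectations as quotients
  rw [integral_tilted_div' f (fun ω => F ω * G ω), integral_tilted_div' f F, integral_tilted_div' f G]
  have e1 : ∫ ω, exp (f ω) * (F ω * G ω) ∂μ = ∫ ω, exp (f ω) * F ω * G ω ∂μ :=
    integral_congr_ae (ae_of_all _ fun ω => by ring)
  rw [e1]
  field_simp
  ring

/-- **AND ITS SIZE**: `|cov_{μ.tilted f}(F, G)| ≤ e^{B}|cov_μ(eF, G)| + e^{B} M_F |cov_μ(e, G)|` for `|f| ≤ B`, `|F| ≤ M_F`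
(`Z ≥ e^{−B}`, `|μ(eF)/Z| ≤ M_F`). -/
theorem abs_covariance_tilted_le {f F G : Ω → ℝ} (hfm : Measurable f) {B : ℝ} (hfb : ∀ ω, |f ω| ≤ B)
    (hFm : Measurable F) {CF : ℝ} (hFb : ∀ ω, |F ω| ≤ CF) (hGm : Measurable G) {CG : ℝ} (hGb : ∀ ω, |G ω| ≤ CG) :
    |cov[F, G; μ.tilted f]| ≤
      exp B * |cov[fun ω => exp (f ω) * F ω, G; μ]| + exp B * CF * |cov[fun ω => exp (f ω), G; μ]| := by
  have heb : ∀ ω, |exp (f ω)| ≤ exp B := fun ω => by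
    rw [abs_of_pos (exp_pos _)]; exact exp_le_exp.2 (abs_le.1 (hfb ω)).2
  have hem : Measurable fun ω => exp (f ω) := hfm.exp
  have hint : Integrable (fun ω => exp (f ω)) μ := integrable_of_abs_le' hem heb
  haveI : IsProbabilityMeasure (μ.tilted f) := isProbabilityMeasure_tilted hint
  have hZ : 0 < ∫ ω, exp (f ω) ∂μ := integral_exp_pos hint
  obtain ⟨ω₀⟩ : Nonempty Ω := by
    by_contra h
    rw [not_nonempty_iff] at h
    have h1 := IsProbabilityMeasure.measure_univ (μ := μ)
    rw [Set.univ_eq_empty_iff.2 h, measure_empty] at h1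
    exact zero_ne_one h1
  have hCF : 0 ≤ CF := (abs_nonneg _).trans (hFb ω₀)
  -- `Z ≥ e^{-B}`, so `1/Z ≤ e^{B}`
  have hZlow : exp (-B) ≤ ∫ ω, exp (f ω) ∂μ := by
    have h1 : ∫ _ω, exp (-B) ∂μ ≤ ∫ ω, exp (f ω) ∂μ :=
      integral_mono (integrable_const _) hint fun ω => exp_le_exp.2 (abs_le.1 (hfb ω)).1
    simpa using h1
  have hinvZ : (∫ ω, exp (f ω) ∂μ)⁻¹ ≤ exp B := by
    rw [inv_le_comm₀ hZ (exp_pos B), ← Real.exp_neg]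
    exact hZlow
  -- `|ν(F)| ≤ CF`
  have hνF : |(∫ ω, exp (f ω) * F ω ∂μ) / ∫ ω, exp (f ω) ∂μ| ≤ CF := by
    rw [← integral_tilted_div' f F]
    have h1 : |∫ ω, F ω ∂μ.tilted f| ≤ ∫ ω, |F ω| ∂μ.tilted f := abs_integral_le_integral_abs
    refine h1.trans ?_
    have h2 : ∫ ω, |F ω| ∂μ.tilted f ≤ ∫ _ω, CF ∂μ.tilted f :=
      integral_mono_of_nonneg (ae_of_all _ fun ω => abs_nonneg _) (integrable_const _) (ae_of_all _ hFb)
    simpa using h2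
  rw [covariance_tilted_eq hfm hfb hFm hFb hGm hGb]
  refine (abs_sub _ _).trans (add_le_add ?_ ?_)
  · rw [abs_div, abs_of_pos hZ, div_eq_mul_inv, mul_comm]
    exact mul_le_mul_of_nonneg_right hinvZ (abs_nonneg _)
  · rw [abs_mul, abs_div (cov[fun ω => exp (f ω), G; μ]), abs_of_pos hZ, div_eq_mul_inv (|cov[_, G; μ]|)]
    calc |(∫ ω, exp (f ω) * F ω ∂μ) / ∫ ω, exp (f ω) ∂μ| * (|cov[fun ω => exp (f ω), G; μ]| * (∫ ω, exp (f ω) ∂μ)⁻¹)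
        ≤ CF * (|cov[fun ω => exp (f ω), G; μ]| * exp B) :=
          mul_le_mul hνF (mul_le_mul_of_nonneg_left hinvZ (abs_nonneg _)) (by positivity) hCF
      _ = exp B * CF * |cov[fun ω => exp (f ω), G; μ]| := by ring

end Tilt

end Summit.Ventures.YMGap.RobustBall

end
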